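import Literature.Analysis.FluidPDE.KwonMollifiedDriftTimeDerivative
import Literature.Analysis.FluidPDE.KwonMollifiedDriftSmooth
import HarnessLib

/-!
# Kwon's time-mollified drift: the full time derivative through the Navier–Stokes equations

Analysis/FluidPDE proof file (theorems only) on the discharge path of the named fact
`Literature.Analysis.FluidPDE.kwon2023_velocity_epsilon_regularity`
(`PressureFreeEpsilonRegularity.lean`; H. Kwon, J. Differential Equations (2023) =
arXiv:2104.03160, Thm. 1.4). `KwonMollifiedDriftTimeDerivative` computes
`d/dt ⟪h_ρ(t,x), c⟫ = (ρ ⋆ g_{x,c})(t)` for every fixed vector `c`; since `h_ρ` is jointly smooth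
(`KwonMollifiedDriftSmooth`), this file assembles the VECTOR identity

  `∂ₜh_ρ(t,x) = Σᵢ (ρ ⋆ g_{x,eᵢ})(t) eᵢ`,  `−4 + r < t < −r`

(`Kwon2023.timeDeriv_timeConv_driftField_eq_sum`), the form in which the forcing
`∂ₜh_ρ − Δh_ρ` of the remainder inequality `Kwon2023.mollifiedDrift_remainder_local_energy_inequality`
is evaluated (step (S2) of the local energy clause of Lemma 2.5, memo `kits/A4-needsX-lit-a4.md`).
No NS-regularity statement is touched.

## Mathlib / tree search

Tree (reused): `hasDerivAt_inner_timeConv_driftField` (`KwonMollifiedDriftTimeDerivative`),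
`contDiff_timeConv_driftField` (`KwonMollifiedDriftSmooth`),
`IsSmoothSpaceTimeOn.of_contDiff_univ/hasDerivWithinAt_timeDerivWithin`, `timeDerivWithin_of_mem_interior`.
Mathlib: `HasDerivAt.inner`, `HasDerivAt.unique`, `OrthonormalBasis.sum_repr'`, `EuclideanSpace.basisFun`.

## References

* H. Kwon, *The role of the pressure in the regularity theory for the Navier–Stokes equations*,
  J. Differential Equations 357 (2023) = arXiv:2104.03160: Remark 2.3 (2.3) and Lemma 2.5 (proof,
  p. 8–9). [Kwon2023RolePressure]
-/

noncomputable section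

open MeasureTheory Set Function Filter Topology TopologicalSpace Metric InnerProductSpace
  ContinuousLinearMap
open scoped NNReal ENNReal RealInnerProductSpace Convolution ContDiff Laplacian

namespace Literature.Analysis.FluidPDE

namespace Kwon2023

variable {u W : ℝ → EuclideanSpace ℝ (Fin 3) → EuclideanSpace ℝ (Fin 3)} {p : ℝ → EuclideanSpace ℝ (Fin 3) → ℝ}

/-- **The time derivative of the mollified drift is the mollified Navier–Stokes right-hand side
tested against the kernel of `H`**, vector form: for a distributional Navier–Stokes solution
`(u, p)` on `Q₂(0)`, its good representative `W`, a bump `ρ` of radius `r` and `−4 + r < t < −r`,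
`∂ₜh_ρ(t,x) = Σᵢ (∫ ρ(t − s) g_{x,eᵢ}(s) ds) eᵢ` with
`g_{x,c}(s) = ∫ (⟪W,(W·∇)η_{x,c}⟫ + ⟪W, Δη_{x,c}⟫ + p div η_{x,c})(s,y) dy`,
`η_{x,c}(y) = ⟪∇k(x − y), c⟫ ∇φ(y) − (c × ∇k(x − y)) × ∇φ(y)`, `eᵢ` the standard basis.
[cite: Kwon2023RolePressure, Lemma 2.5 (proof, p. 8–9) with Remark 2.3 (2.3)] -/
theorem timeDeriv_timeConv_driftField_eq_sum (hW : IsGoodVelocity W)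
    (hu : IsDistributionalNSSolutionOn (parabolicCylinderOpens 2 (0 : ℝ × EuclideanSpace ℝ (Fin 3))) 1 0 u p)
    (hWu : uncurry W =ᵐ[volume]
      (parabolicCylinder 2 (0 : ℝ × EuclideanSpace ℝ (Fin 3))).indicator (uncurry u))
    (φ : ContDiffBump (0 : ℝ)) (x : EuclideanSpace ℝ (Fin 3)) {t : ℝ}
    (ht₁ : -4 + φ.rOut < t) (ht₂ : t + φ.rOut < 0) :
    timeDeriv (fun s y => (φ.normed volume ⋆[lsmul ℝ ℝ, volume] fun σ => driftField W σ y) s) t x =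
      ∑ i : Fin 3, (∫ s, φ.normed volume (t - s) *
        ∫ y, (⟪W s y, fderiv ℝ (fun y => ⟪gradient annularKernel (x - y),
              (EuclideanSpace.basisFun (Fin 3) ℝ i : EuclideanSpace ℝ (Fin 3))⟫ • gradient kwonCutoff y -
            cross (cross (EuclideanSpace.basisFun (Fin 3) ℝ i : EuclideanSpace ℝ (Fin 3))
              (gradient annularKernel (x - y))) (gradient kwonCutoff y)) y (W s y)⟫ +
          ⟪W s y, Δ (fun y => ⟪gradient annularKernel (x - y),
              (EuclideanSpace.basisFun (Fin 3) ℝ i : EuclideanSpace ℝ (Fin 3))⟫ • gradient kwonCutoff y -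
            cross (cross (EuclideanSpace.basisFun (Fin 3) ℝ i : EuclideanSpace ℝ (Fin 3))
              (gradient annularKernel (x - y))) (gradient kwonCutoff y)) y⟫ +
          p s y * VectorCalculus.divergence (fun y => ⟪gradient annularKernel (x - y),
              (EuclideanSpace.basisFun (Fin 3) ℝ i : EuclideanSpace ℝ (Fin 3))⟫ • gradient kwonCutoff y -
            cross (cross (EuclideanSpace.basisFun (Fin 3) ℝ i : EuclideanSpace ℝ (Fin 3))
              (gradient annularKernel (x - y))) (gradient kwonCutoff y)) y)) •
        (EuclideanSpace.basisFun (Fin 3) ℝ i : EuclideanSpace ℝ (Fin 3)) := by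
  set b := EuclideanSpace.basisFun (Fin 3) ℝ with hb
  set e : ℝ → EuclideanSpace ℝ (Fin 3) → EuclideanSpace ℝ (Fin 3) := fun s y =>
    (φ.normed volume ⋆[lsmul ℝ ℝ, volume] fun σ => driftField W σ y) s with he_def
  have he : ContDiff ℝ (⊤ : ℕ∞) (uncurry e) := contDiff_timeConv_driftField hW φ
  have hes : IsSmoothSpaceTimeOn univ e := IsSmoothSpaceTimeOn.of_contDiff_univ he
  have htd : timeDerivWithin univ e t x = timeDeriv e t x :=
    timeDerivWithin_of_mem_interior (by rw [interior_univ]; exact mem_univ _) x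
  have hd : HasDerivAt (fun s => e s x) (timeDeriv e t x) t := by
    have h := (hes.hasDerivWithinAt_timeDerivWithin uniqueDiffOn_univ (mem_univ t) x).hasDerivAt univ_mem
    rwa [htd] at h
  -- the coordinates of `∂ₜe(t,x)`
  have hcoord : ∀ i : Fin 3, ⟪timeDeriv e t x, (b i : EuclideanSpace ℝ (Fin 3))⟫ =
      ∫ s, φ.normed volume (t - s) *
        ∫ y, (⟪W s y, fderiv ℝ (fun y => ⟪gradient annularKernel (x - y), (b i : EuclideanSpace ℝ (Fin 3))⟫ •
              gradient kwonCutoff y -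
            cross (cross (b i : EuclideanSpace ℝ (Fin 3)) (gradient annularKernel (x - y))) (gradient kwonCutoff y))
              y (W s y)⟫ +
          ⟪W s y, Δ (fun y => ⟪gradient annularKernel (x - y), (b i : EuclideanSpace ℝ (Fin 3))⟫ •
              gradient kwonCutoff y -
            cross (cross (b i : EuclideanSpace ℝ (Fin 3)) (gradient annularKernel (x - y))) (gradient kwonCutoff y)) y⟫ +
          p s y * VectorCalculus.divergence (fun y => ⟪gradient annularKernel (x - y), (b i : EuclideanSpace ℝ (Fin 3))⟫ •
              gradient kwonCutoff y -
            cross (cross (b i : EuclideanSpace ℝ (Fin 3)) (gradient annularKernel (x - y))) (gradient kwonCutoff y)) y) := by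
    intro i
    have h1 : HasDerivAt (fun s => ⟪e s x, (b i : EuclideanSpace ℝ (Fin 3))⟫)
        ⟪timeDeriv e t x, (b i : EuclideanSpace ℝ (Fin 3))⟫ t := by
      have h := hd.inner ℝ (hasDerivAt_const t (b i : EuclideanSpace ℝ (Fin 3)))
      simpa only [inner_zero_right, zero_add] using h
    have h2 := hasDerivAt_inner_timeConv_driftField hW hu hWu φ x (b i : EuclideanSpace ℝ (Fin 3)) ht₁ ht₂
    exact h1.unique h2
  calc timeDeriv e t x = ∑ i : Fin 3, ⟪(b i : EuclideanSpace ℝ (Fin 3)), timeDeriv e t x⟫ •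
        (b i : EuclideanSpace ℝ (Fin 3)) := (b.sum_repr' _).symm
    _ = _ := Finset.sum_congr rfl fun i _ => by rw [real_inner_comm, hcoord i]

end Kwon2023

end Literature.Analysis.FluidPDE

end
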